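/-
Copyright (c) 2026 the pub-hodgecm-mathlib formalisation cell (harness21).  Prover seat hodgecm-mathlib-F0P2-p01 (g13), 2026-09-01.  Road «S3-tree»: ORDER-STABILITY over an
ARBITRARY coefficient ring (currency-free twin of ★ `UnitaryLatticeTreeOrderStability` §1–§2, serving the `ValuativeRel` files of O8b ∕ ROW-0 as well as the `Valued` T1a files).
-/
import Mathlib.LinearAlgebra.Matrix.GeneralLinearGroup.Defs
import Mathlib.LinearAlgebra.Matrix.ToLin
import Mathlib.RingTheory.Adjoin.Basic
import HarnessLib

/-!
# Stability of a module under a matrix is stability under its order — coefficient-ring-free form (road «S3-tree», ROW-0 ∕ O8b seam; Kottwitz 1986 §3)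

Topic `NumberTheory/Automorphic`; namespace `Literature.NumberTheory.Automorphic.OrderStability`.  THEOREMS ONLY (no definition, no instance, no notation, no named fact,
no `sorry`).  For ANY commutative ring `R` with `Algebra R K` (`K` a field), any `R`-submodule `M ⊆ K^N` and matrices over `K` (an `R`-algebra): `X·M ⊆ M ⇒ Y·M ⊆ M` for every
`Y ∈ R[X] = Algebra.adjoin R {X}` (§1), hence equal orders have the same stable modules, and for a unit `u ∈ GL_N(K)` with `u, u⁻¹ ∈ R[X]`, `X ∈ R[u]`: `X·M ⊆ M ↔ u·M = M` (§2).
This is ★ `UnitaryLatticeTreeOrderStability` (p845548) §1–§2 with the coefficient ring `𝒪[K]` of a `Valued` field replaced by an arbitrary `R` — the proofs there use no valuation —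
so that the `[ValuativeRel E]`-currency files (★ `ResiduallyUnipotentFixedCosetCount.ncard_fixedBy_unitary_sep_eq_ncard`, ★ B-p10 `FixedCosetsLevelShift`, O8b ∕ ROW-0 of T3′) can
cite the order-stability step BY NAME with `R := 𝒪[E]` (seam α of the road: no `Valued ↔ ValuativeRel` bridge, architect A-59 (1)).  Cell `pub/hodgecm-mathlib` (D-0151), crux
H413 = `stmt-HodgeConjecture-24833`; seat F0P2-p01 (g13); T3′ F0P3b-p01 (g11) 2026-09-01T17:20:47Z (3).  HONEST LABEL: HC_CM is proved only modulo the 2 remaining named inputs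
(hLiu418 24832, h413 24833) until rung 0 closes; nothing printed is asserted here.

* §1 `map_le_of_mem_adjoin`, `map_le_iff_of_adjoin_eq`.
* §2 `map_units_eq_of_map_le`, `map_le_of_map_units_eq`, `map_units_eq_iff_map_le`.

## References
* [Kottwitz1986] R. E. Kottwitz, *Base change for unit elements of Hecke algebras*, Compositio Math. 60 (1986): §3 (fixed cosets ↔ lattices stable under an order).
* [Serre1980Trees] J.-P. Serre, *Trees* (1980): Ch. II §1.1.
-/

set_option autoImplicit false

open scoped Matrix MatrixGroups

namespace Literature.NumberTheory.Automorphic.OrderStability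

variable {R K : Type*} [CommRing R] [Field K] [Algebra R K] {N : ℕ}

/-! ## §1 Stability under `X` is stability under the order `R[X]` -/

/-- Pointwise form of stability: `M.map (toLin' Z) ≤ M ↔ ∀ m ∈ M, Z *ᵥ m ∈ M`. [cite: Serre1980Trees, Ch. II §1.1] -/
theorem map_le_iff_forall_mulVec_mem (M : Submodule R (Fin N → K)) (Z : Matrix (Fin N) (Fin N) K) :
    M.map ((Matrix.toLin' Z).restrictScalars R) ≤ M ↔ ∀ m ∈ M, Z.mulVec m ∈ M := by
  constructor
  · intro h m hm
    exact h (Submodule.mem_map.2 ⟨m, hm, by rw [LinearMap.restrictScalars_apply, Matrix.toLin'_apply]⟩)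
  · intro h x hx
    obtain ⟨m, hm, rfl⟩ := Submodule.mem_map.1 hx
    rw [LinearMap.restrictScalars_apply, Matrix.toLin'_apply]
    exact h m hm

/-- **A module stable under `X` is stable under every element of the order `R[X] = Algebra.adjoin R {X} ⊆ M_N(K)`.** [cite: Kottwitz1986, §3] -/
theorem map_le_of_mem_adjoin (M : Submodule R (Fin N → K)) {X Y : Matrix (Fin N) (Fin N) K}
    (hX : M.map ((Matrix.toLin' X).restrictScalars R) ≤ M) (hY : Y ∈ Algebra.adjoin R ({X} : Set (Matrix (Fin N) (Fin N) K))) :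
    M.map ((Matrix.toLin' Y).restrictScalars R) ≤ M := by
  rw [map_le_iff_forall_mulVec_mem] at hX ⊢
  induction hY using Algebra.adjoin_induction with
  | mem Z hZ =>
      rw [Set.mem_singleton_iff] at hZ
      subst hZ
      exact hX
  | algebraMap r =>
      intro m hm
      rw [Algebra.algebraMap_eq_smul_one, Matrix.smul_mulVec, Matrix.one_mulVec]
      exact M.smul_mem r hm
  | add Z W _ _ hZ hW =>
      intro m hm
      rw [Matrix.add_mulVec]
      exact M.add_mem (hZ m hm) (hW m hm)
  | mul Z W _ _ hZ hW =>
      intro m hm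
      rw [← Matrix.mulVec_mulVec]
      exact hZ _ (hW m hm)

/-- **Equal orders have the same stable modules**: `R[X] = R[Y] ⇒ (X·M ⊆ M ↔ Y·M ⊆ M)`. [cite: Kottwitz1986, §3] -/
theorem map_le_iff_of_adjoin_eq (M : Submodule R (Fin N → K)) {X Y : Matrix (Fin N) (Fin N) K}
    (h : Algebra.adjoin R ({X} : Set (Matrix (Fin N) (Fin N) K)) = Algebra.adjoin R ({Y} : Set (Matrix (Fin N) (Fin N) K))) :
    M.map ((Matrix.toLin' X).restrictScalars R) ≤ M ↔ M.map ((Matrix.toLin' Y).restrictScalars R) ≤ M :=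
  ⟨fun hX => map_le_of_mem_adjoin M hX (h ▸ Algebra.self_mem_adjoin_singleton R Y),
    fun hY => map_le_of_mem_adjoin M hY (h.symm ▸ Algebra.self_mem_adjoin_singleton R X)⟩

/-! ## §2 A unit generating the same order: stability ↔ being fixed -/

/-- **`X·M ⊆ M` ⇒ `u·M = M`** for a unit `u ∈ GL_N(K)` with `u, u⁻¹ ∈ R[X]`. [cite: Kottwitz1986, §3] [cite: Serre1980Trees, Ch. II §1.1] -/
theorem map_units_eq_of_map_le (M : Submodule R (Fin N → K)) {X : Matrix (Fin N) (Fin N) K} (u : GL (Fin N) K)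
    (hu : (u : Matrix (Fin N) (Fin N) K) ∈ Algebra.adjoin R ({X} : Set (Matrix (Fin N) (Fin N) K)))
    (hu' : ((u⁻¹ : GL (Fin N) K) : Matrix (Fin N) (Fin N) K) ∈ Algebra.adjoin R ({X} : Set (Matrix (Fin N) (Fin N) K)))
    (hX : M.map ((Matrix.toLin' X).restrictScalars R) ≤ M) : M.map ((Matrix.toLin' (u : Matrix (Fin N) (Fin N) K)).restrictScalars R) = M := by
  refine le_antisymm (map_le_of_mem_adjoin M hX hu) ?_
  intro m hm
  have h1 : ((Matrix.toLin' ((u⁻¹ : GL (Fin N) K) : Matrix (Fin N) (Fin N) K)).restrictScalars R) m ∈ M :=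
    map_le_of_mem_adjoin M hX hu' (Submodule.mem_map.2 ⟨m, hm, rfl⟩)
  refine Submodule.mem_map.2 ⟨_, h1, ?_⟩
  rw [LinearMap.restrictScalars_apply, LinearMap.restrictScalars_apply, Matrix.toLin'_apply, Matrix.toLin'_apply, Matrix.mulVec_mulVec,
    ← Units.val_mul, mul_inv_cancel, Units.val_one, Matrix.one_mulVec]

/-- **`u·M = M` ⇒ `X·M ⊆ M`** for `X ∈ R[u]`. [cite: Kottwitz1986, §3] -/
theorem map_le_of_map_units_eq (M : Submodule R (Fin N → K)) {X : Matrix (Fin N) (Fin N) K} (u : GL (Fin N) K)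
    (hX : X ∈ Algebra.adjoin R ({(u : Matrix (Fin N) (Fin N) K)} : Set (Matrix (Fin N) (Fin N) K)))
    (h : M.map ((Matrix.toLin' (u : Matrix (Fin N) (Fin N) K)).restrictScalars R) = M) :
    M.map ((Matrix.toLin' X).restrictScalars R) ≤ M :=
  map_le_of_mem_adjoin M (X := (u : Matrix (Fin N) (Fin N) K)) h.le hX

/-- **Stability under `X` ↔ fixed by `u`**, for a unit `u` with `u, u⁻¹ ∈ R[X]` and `X ∈ R[u]` (e.g. T3′'s Cayley element `u = Y`, `X = ϖ⁻¹(t − 1)`; then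
«`Λ.map X ≤ Λ` for all `X ∈ R[Y]` ⟺ `Λ.map Y = Λ`»). [cite: Kottwitz1986, §3] [cite: Serre1980Trees, Ch. II §1.1] -/
theorem map_units_eq_iff_map_le (M : Submodule R (Fin N → K)) {X : Matrix (Fin N) (Fin N) K} (u : GL (Fin N) K)
    (hu : (u : Matrix (Fin N) (Fin N) K) ∈ Algebra.adjoin R ({X} : Set (Matrix (Fin N) (Fin N) K)))
    (hu' : ((u⁻¹ : GL (Fin N) K) : Matrix (Fin N) (Fin N) K) ∈ Algebra.adjoin R ({X} : Set (Matrix (Fin N) (Fin N) K)))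
    (hX : X ∈ Algebra.adjoin R ({(u : Matrix (Fin N) (Fin N) K)} : Set (Matrix (Fin N) (Fin N) K))) :
    M.map ((Matrix.toLin' (u : Matrix (Fin N) (Fin N) K)).restrictScalars R) = M ↔ M.map ((Matrix.toLin' X).restrictScalars R) ≤ M :=
  ⟨map_le_of_map_units_eq M u hX, map_units_eq_of_map_le M u hu hu'⟩

/-- **Set form**: for any family predicate `P` (e.g. «`Λ = span R (range (↑v)ᵀ)` for some `v ∈ U(J)`» of ★ `ncard_fixedBy_unitary_sep_eq_ncard`),
`{M | P M ∧ X·M ⊆ M} = {M | P M ∧ u·M = M}`. [cite: Kottwitz1986, §3] -/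
theorem setOf_map_le_eq_setOf_map_units_eq (P : Submodule R (Fin N → K) → Prop) {X : Matrix (Fin N) (Fin N) K} (u : GL (Fin N) K)
    (hu : (u : Matrix (Fin N) (Fin N) K) ∈ Algebra.adjoin R ({X} : Set (Matrix (Fin N) (Fin N) K)))
    (hu' : ((u⁻¹ : GL (Fin N) K) : Matrix (Fin N) (Fin N) K) ∈ Algebra.adjoin R ({X} : Set (Matrix (Fin N) (Fin N) K)))
    (hX : X ∈ Algebra.adjoin R ({(u : Matrix (Fin N) (Fin N) K)} : Set (Matrix (Fin N) (Fin N) K))) :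
    {M : Submodule R (Fin N → K) | P M ∧ M.map ((Matrix.toLin' X).restrictScalars R) ≤ M} =
      {M : Submodule R (Fin N → K) | P M ∧ M.map ((Matrix.toLin' (u : Matrix (Fin N) (Fin N) K)).restrictScalars R) = M} := by
  ext M
  simp only [Set.mem_setOf_eq]
  exact and_congr_right fun _ => (map_units_eq_iff_map_le M u hu hu' hX).symm

end Literature.NumberTheory.Automorphic.OrderStability
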